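import Summits.BirchSwinnertonDyer.BirchSwinnertonDyer.Theorems.PrintCf2RamifiedOffTYZTheoremAHilbertBridge
import Summits.BirchSwinnertonDyer.BirchSwinnertonDyer.Theorems.PrintCf2RamifiedOffTYZTheoremAOrderTwoGroup
import Summits.BirchSwinnertonDyer.BirchSwinnertonDyer.Theorems.PrintCf2RamifiedOffTYZTheoremAAmbiguous
import Literature.NumberTheory.ComplexMultiplication.EllipticUnits.KatoLayerArtinCompatibility
import Literature.NumberTheory.NumberFields.HilbertClassFieldArtinIsomorphism
import Literature.NumberTheory.QuadraticFields.DiscriminantOfSqrt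
import HarnessLib

/-!
# Route `PrintCf2`, crux stmt-BirchSwinnertonDyer-20509 `RamifiedOffTYZOfFacts`, THEOREM A's target (T3), GLOBAL HALF, in the ray class field:
# `g ∈ Gal(K^{(𝔪)}/K)` fixing `√l` ⟹ `g^{g(K)} • s₀ = s₀` whenever `s₀² ∈ H`, granted only «`((l), K^{(𝔪)}/K)` fixes `s₀`»
# (cell `bsd-print-cf2`, LEAD cruxlead-20509 g33, line `offtyz-v7`, lineage cycle 34; Theses-free, `def`-free; Rédei–Reichardt = conjunct 7 of 𝔅_ram as hypothesis)

HONEST FRAMING (`--supports stmt-BirchSwinnertonDyer-20509`; theorems only, no `sorry`, no new named fact).  BSD is not proved by any of this;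
no class is closed by this file; item 23431 (C⁺) and crux 20509 stay OPEN.  This file DRESSES the group theory of `TheoremAOrderTwoGroup` (p813336) with the
class field theory of the tree: `Γ = Gal(R/K)`, `R = rayClassField K 𝔪`; `res : Γ ↠ Cl(K)` = restriction to the Hilbert class field `H ⊆ R`
(`TheoremAHilbertBridge.hilbertClassField_le_rayClassField`) followed by the inverse Artin isomorphism `Gal(H/K) ≅ Cl(K)` (tree `hilbertClassField.artinEquiv`);
its kernel fixes `H` pointwise; it maps the Artin symbol `(𝔞, R/K)` to the CLASS `[𝔞]` (Frobenius restricts to Frobenius, `TheoremAOrderTwoGroup`-free);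
the arithmetic of `K = ℚ(√−lq)` (`TheoremAAmbiguous`: `#Cl[2] = 2`, `#Cl = 2g` with `g` even, the ambiguous ideal `𝔭 = (l, √−lq)` with `𝔭² = (l)` not
principal) supplies the remaining hypotheses, with `p = (𝔭, R/K)`, `p² = ((l), R/K)`.

* `artinSymbol_classGroupMk0` — `∏ [𝔭_v]^{ν_v(𝔞)} = [𝔞]` in `Cl(K)`;
* `exists_res` — the homomorphism `res : Gal(R/K) →* Cl(K)`: onto; `res π = 1 ⟹ π` fixes `H ⊆ R` pointwise; `res (𝔞, R/K) = [𝔞]` for every `𝔞 ≠ 0`;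
* `not_isSquare_natCast_of_prime` — `l` is not a square in an imaginary quadratic field (`l ≡ 1 (mod 4)` prime: `d_K` would be `l > 0`);
* ★★ `pow_genusClassNumber_apply_eq_self` — **(T3), GLOBAL HALF**: for `K` imaginary quadratic with `d_K = −lq` (`l ≡ 1 (mod 8)`, `q ≡ 7 (mod 8)`… only
  `l ≡ 1 (mod 4)`, `q ≡ 3 (mod 4)`, `q > 4`, `(l/q) = 1` are used), `w ∈ 𝓞 K` with `w² = −lq`, `𝔪 ≠ 0`, `s₀ ∈ R` with `s₀² ∈ H`, and
  «`((l), R/K) • s₀ = s₀`» (the LOCAL half, `TheoremAOrderTwoLocal`, p812177, to be fed in the assembly where Cox's display lives): every `g ∈ Gal(R/K)`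
  fixing the square root of `l` in `H ⊆ R` satisfies `g^{genusClassNumber K} s₀ = s₀`.

References: [cite: NeukirchANT1999, Ch. VI §6 (6.9), §7 (7.1), (7.3)]; [cite: Childress2009, Ch. 5 §1 Cor. 1.2]; [cite: Cox2013, Thm. 8.10, §6.A Thm. 6.1];
LEAD g29 memo `Lines/offtyz_v7_ExactDescent.md` §2c (transfer); tree p813131, p813336, `TheoremAAmbiguous`, p812177.
-/

noncomputable section

open scoped Classical nonZeroDivisors
open NumberField IsDedekindDomain

namespace Summit.BirchSwinnertonDyer.PrintCf2.TheoremAOrderTwoGlobal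

open Literature.NumberTheory.EllipticCurves Literature.NumberTheory.NumberFields Literature.NumberTheory.GaloisRepresentations
open Literature.NumberTheory.LFunctions.AbelianDensity (artinSymbol artinSymbol_mul artinSymbol_asIdeal)
open Literature.NumberTheory.ComplexMultiplication.EllipticUnits (artinSymbol_congr_of_dvd)
open Literature.NumberTheory.EllipticCurves.Tian2014 (IsQuadraticFieldOfSqrt)
open Literature.NumberTheory.QuadraticFields.RedeiReichardt (redeiReichardt_fourTwoCard_classGroup)
open Literature.NumberTheory.EllipticCurves.TianYuanZhang2017 (genusClassNumber)
open Literature.NumberTheory.QuadraticFields.Quadratic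
open Summit.BirchSwinnertonDyer.PrintCf2.TheoremAHilbertBridge Summit.BirchSwinnertonDyer.PrintCf2.TheoremAOrderTwoGroup
open Summit.BirchSwinnertonDyer.PrintCf2.TheoremAAmbiguous Summit.BirchSwinnertonDyer.PrintCf2.TheoremACMAssembly

variable {K : Type} [Field K] [NumberField K]

/-! ## §1 The Artin symbol with values in the class group is the class -/

/-- **`∏_v [𝔭_v]^{ν_v(𝔞)} = [𝔞]` in `Cl(K)`** for every non-zero ideal `𝔞` (induction on the prime factorisation). [folklore] -/
theorem artinSymbol_classGroupMk0 (I : Ideal (𝓞 K)) (hI : I ≠ ⊥) :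
    artinSymbol (fun v : HeightOneSpectrum (𝓞 K) => ClassGroup.mk0 ⟨v.asIdeal, asIdeal_mem_nonZeroDivisors v⟩) I =
      ClassGroup.mk0 ⟨I, mem_nonZeroDivisors_of_ne_zero hI⟩ := by
  set f := fun v : HeightOneSpectrum (𝓞 K) => ClassGroup.mk0 ⟨v.asIdeal, asIdeal_mem_nonZeroDivisors v⟩ with hf
  induction I using UniqueFactorizationMonoid.induction_on_prime with
  | h₁ => exact absurd rfl hI
  | h₂ J hJ =>
    have hJ' : J = ⊤ := Ideal.isUnit_iff.mp hJ
    subst hJ'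
    -- `F(⊤)² = F(⊤ · ⊤) = F(⊤)`, so `F(⊤) = 1`; and `[⊤] = 1`
    have hsq : artinSymbol f (⊤ : Ideal (𝓞 K)) * artinSymbol f ⊤ = artinSymbol f ⊤ := by
      rw [← artinSymbol_mul f top_ne_bot top_ne_bot, Ideal.top_mul]
    have h1 : artinSymbol f (⊤ : Ideal (𝓞 K)) = 1 := mul_eq_left.mp hsq
    rw [h1]
    have : (⟨(⊤ : Ideal (𝓞 K)), mem_nonZeroDivisors_of_ne_zero hI⟩ : (Ideal (𝓞 K))⁰) = 1 := Subtype.ext Ideal.one_eq_top.symm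
    rw [this, map_one]
  | h₃ J P hJ hP ih =>
    have hP' : P ≠ ⊥ := hP.ne_zero
    have hJ' : J ≠ ⊥ := hJ
    rw [artinSymbol_mul f hP' hJ']
    let v : HeightOneSpectrum (𝓞 K) := ⟨P, Ideal.isPrime_of_prime hP, hP'⟩
    have hv : artinSymbol f P = ClassGroup.mk0 ⟨P, mem_nonZeroDivisors_of_ne_zero hP'⟩ := artinSymbol_asIdeal f v
    rw [hv, ih hJ', ← map_mul]
    rfl

/-! ## §2 The restriction `res : Gal(R/K) ↠ Cl(K)` -/

section Abstract

variable {E E' : IntermediateField K (AlgebraicClosure K)}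

omit [NumberField K] in
/-- `K → E → E′` is a scalar tower for the inclusion algebra structure (ABSTRACT intermediate fields, so that the defining `rfl` is kernel-cheap).
[folklore] -/
theorem isScalarTower_inclusion (h : E ≤ E') :
    letI := (IntermediateField.inclusion h).toRingHom.toAlgebra
    IsScalarTower K E E' :=
  letI := (IntermediateField.inclusion h).toRingHom.toAlgebra
  IsScalarTower.of_algebraMap_eq fun _ ↦ rfl

omit [NumberField K] in
/-- For the inclusion algebra structure, `algebraMap E E′ = inclusion`. [folklore] -/
theorem algebraMap_inclusion_apply (h : E ≤ E') (x : E) :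
    letI := (IntermediateField.inclusion h).toRingHom.toAlgebra
    algebraMap E E' x = IntermediateField.inclusion h x :=
  rfl

end Abstract

/-- ★ **The homomorphism `res : Gal(K^{(𝔪)}/K) →* Cl(K)`** — restriction to the Hilbert class field `H ⊆ K^{(𝔪)}` followed by the inverse of the Artin
isomorphism `Cl(K) ≅ Gal(H/K)`: it is ONTO, its kernel fixes `H` pointwise, and it sends the Artin symbol `(𝔞, K^{(𝔪)}/K) = ∏ Frob_v^{ν_v(𝔞)}` to the
class `[𝔞]` (Frobenius restricts to Frobenius, `H/K` being unramified everywhere).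
[cite: NeukirchANT1999, Ch. VI §6 Prop. (6.9) and §7 (7.1), (7.3)] [cite: Childress2009, Ch. 5 §1 Cor. 1.2] -/
theorem exists_res {𝔪 : Ideal (𝓞 K)} (h𝔪 : 𝔪 ≠ ⊥) :
    ∃ res : (rayClassField K 𝔪 ≃ₐ[K] rayClassField K 𝔪) →* ClassGroup (𝓞 K),
      Function.Surjective res ∧
      (∀ π, res π = 1 → ∀ h : hilbertClassField K,
        π (IntermediateField.inclusion (hilbertClassField_le_rayClassField h𝔪) h) = IntermediateField.inclusion (hilbertClassField_le_rayClassField h𝔪) h) ∧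
      (∀ (I : Ideal (𝓞 K)) (hI : I ≠ ⊥), res (artinSymbol (galFrob K (rayClassField K 𝔪)) I) = ClassGroup.mk0 ⟨I, mem_nonZeroDivisors_of_ne_zero hI⟩) := by
  set H := hilbertClassField K with hHdef
  set R := rayClassField K 𝔪 with hRdef
  have hHR : H ≤ R := hilbertClassField_le_rayClassField h𝔪
  letI : Algebra H R := (IntermediateField.inclusion hHR).toRingHom.toAlgebra
  haveI : IsScalarTower K H R := isScalarTower_inclusion hHR
  let r : (R ≃ₐ[K] R) →* (H ≃ₐ[K] H) := AlgEquiv.restrictNormalHom H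
  let res : (R ≃ₐ[K] R) →* ClassGroup (𝓞 K) := (hilbertClassField.artinEquiv K).symm.toMonoidHom.comp r
  have hres : ∀ π, res π = (hilbertClassField.artinEquiv K).symm (r π) := fun π => rfl
  refine ⟨res, ?_, ?_, ?_⟩
  · exact (hilbertClassField.artinEquiv K).symm.surjective.comp (AlgEquiv.restrictNormalHom_surjective R)
  · intro π hπ h
    have hr : r π = 1 := by
      rw [hres, MulEquiv.map_eq_one_iff] at hπ; exact hπ
    have hcomm := AlgEquiv.restrictNormal_commutes π H h
    rw [algebraMap_inclusion_apply hHR, algebraMap_inclusion_apply hHR] at hcomm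
    rw [← hcomm]
    change IntermediateField.inclusion hHR ((r π) h) = _
    rw [hr, AlgEquiv.one_apply]
  · intro I hI
    rw [Literature.NumberTheory.GaloisRepresentations.map_artinSymbol res _ hI]
    rw [artinSymbol_congr_of_dvd hI (g := fun v : HeightOneSpectrum (𝓞 K) => ClassGroup.mk0 ⟨v.asIdeal, asIdeal_mem_nonZeroDivisors v⟩)
      (fun v _ => ?_), artinSymbol_classGroupMk0 I hI]
    rw [Function.comp_apply, hres, MulEquiv.symm_apply_eq, hilbertClassField.artinEquiv_mk0_eq_galFrob]
    exact restrictNormalHom_galFrob_eq_galFrob_of_isUnramifiedIn (commute_of_isAbelianGalois H) (hilbertClassField.isUnramifiedIn K v)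

/-! ## §3 `√l ∉ K` -/

/-- **A prime `l ≡ 1 (mod 4)` is not a square in an imaginary quadratic field** (else `d_K = l > 0`). [cite: Marcus2018, Ch. 2 Thm. 1] -/
theorem not_isSquare_natCast_of_prime (hK : IsImaginaryQuadratic K) {l : ℕ} (hl : l.Prime) (hl4 : l % 4 = 1) : ¬ IsSquare ((l : ℕ) : K) := by
  rintro ⟨k, hk⟩
  have hsq : k ^ 2 = ((l : ℤ) : K) := by rw [pow_two, ← hk, Int.cast_natCast]
  have hl4' : (l : ℤ) % 4 = 1 := by exact_mod_cast hl4
  have hd := discr_eq_of_sq_eq_intCast_of_squarefree_natAbs hK.1 hsq hl4' (by simpa using hl.squarefree)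
    (by have := hl.two_le; omega)
  have hneg := hK.discr_neg
  rw [hd] at hneg
  have := hl.pos
  omega

/-! ## §4 (T3), GLOBAL HALF, in the ray class field -/

/-- ★★ **(T3), GLOBAL HALF.**  `K` imaginary quadratic with `d_K = −lq` (`l ≡ 1 (mod 4)`, `q ≡ 3 (mod 4)`, `q > 4` primes, `(l/q) = 1`), `w ∈ 𝓞 K` with
`w² = −lq`, `𝔪 ≠ 0`, `R = rayClassField K 𝔪 ⊇ H`; `s₀ ∈ R` with `s₀² ∈ H`; `r ∈ H` with `r² = l`; and the LOCAL input «`((l), R/K) • s₀ = s₀`».  THEN every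
`g ∈ Gal(R/K)` with `g r = r` satisfies `g^{g(K)} s₀ = s₀`, `g(K) = genusClassNumber K = #Cl(K)²` — GRANTED Rédei–Reichardt (conjunct 7 of 𝔅_ram, for
`g(K)` even).  Proof: `TheoremAOrderTwoGroup.pow_smul_eq_self_of_smul_eq` with `res` of `exists_res`, `#Cl[2] = 2`, `#Cl = 2g(K)`, `p = ((l, w), R/K)`
(`res p = [(l, w)] ≠ 1`, `p² = ((l), R/K)`). [cite: NeukirchANT1999, Ch. VI §7 (7.1)] [cite: Cox2013, §6.A Thm. 6.1] [cite: RedeiReichardt1934, Satz] -/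
theorem pow_genusClassNumber_apply_eq_self (hRR : redeiReichardt_fourTwoCard_classGroup) (hK : IsImaginaryQuadratic K) {l q : ℕ}
    (hl : l.Prime) (hq : q.Prime) (hl4 : l % 4 = 1) (hq4 : q % 4 = 3) (hq5 : 4 < q) (hjac : jacobiSym (l : ℤ) q = 1)
    (hd : NumberField.discr K = -((l * q : ℕ) : ℤ)) (hKsq : IsQuadraticFieldOfSqrt K (-((l * q : ℕ) : ℤ)))
    (w : 𝓞 K) (hw : w ^ 2 = -((l * q : ℕ) : 𝓞 K)) {𝔪 : Ideal (𝓞 K)} (h𝔪 : 𝔪 ≠ ⊥)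
    (s₀ : rayClassField K 𝔪) (a : hilbertClassField K)
    (ha : IntermediateField.inclusion (hilbertClassField_le_rayClassField h𝔪) a = s₀ * s₀)
    (r : hilbertClassField K) (hr : (IntermediateField.inclusion (hilbertClassField_le_rayClassField h𝔪) r) ^ 2 = (l : rayClassField K 𝔪))
    (hloc : (artinSymbol (galFrob K (rayClassField K 𝔪)) (Ideal.span {((l : ℕ) : 𝓞 K)})) s₀ = s₀)
    (g : rayClassField K 𝔪 ≃ₐ[K] rayClassField K 𝔪)
    (hg : g (IntermediateField.inclusion (hilbertClassField_le_rayClassField h𝔪) r) = IntermediateField.inclusion (hilbertClassField_le_rayClassField h𝔪) r) :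
    (g ^ genusClassNumber K) s₀ = s₀ := by
  have hlq : l ≠ q := by omega
  have hcop : l.Coprime q := (Nat.coprime_primes hl hq).mpr hlq
  obtain ⟨res, hsurj, hker, hartin⟩ := exists_res (K := K) h𝔪
  -- the ideal `𝔭 = (l, w)` and `p = (𝔭, R/K)`
  set 𝔭 : Ideal (𝓞 K) := Ideal.span {((l : ℕ) : 𝓞 K), w} with h𝔭def
  have hl0 : ((l : ℕ) : 𝓞 K) ≠ 0 := by exact_mod_cast hl.ne_zero
  have h𝔭0 : 𝔭 ≠ ⊥ := by
    intro h
    rw [h𝔭def, Ideal.span_eq_bot] at h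
    exact hl0 (h _ (by simp))
  have hspan0 : (Ideal.span {((l : ℕ) : 𝓞 K)} : Ideal (𝓞 K)) ≠ ⊥ := by
    rw [Ne, Ideal.span_singleton_eq_bot]; exact hl0
  have h𝔭sq : 𝔭 ^ 2 = Ideal.span {((l : ℕ) : 𝓞 K)} := span_pair_sq_eq_span hcop w hw
  set p : rayClassField K 𝔪 ≃ₐ[K] rayClassField K 𝔪 := artinSymbol (galFrob K (rayClassField K 𝔪)) 𝔭 with hpdef
  have hres_p : res p = ClassGroup.mk0 ⟨𝔭, mem_nonZeroDivisors_of_ne_zero h𝔭0⟩ := hartin 𝔭 h𝔭0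
  have hp1 : res p ≠ 1 := by
    rw [hres_p, Ne, ClassGroup.mk0_eq_one_iff]
    exact not_isPrincipal_span_pair hK hl hq5 hcop hd w hw
  have hp2 : res p ^ 2 = 1 := by
    rw [← map_pow, hpdef, pow_two, ← artinSymbol_mul _ h𝔭0 h𝔭0, ← pow_two, h𝔭sq, hartin _ hspan0, ClassGroup.mk0_eq_one_iff]
    exact ⟨(l : 𝓞 K), rfl⟩
  have hps : (p ^ 2) • s₀ = s₀ := by
    rw [hpdef, pow_two, ← artinSymbol_mul _ h𝔭0 h𝔭0, ← pow_two, h𝔭sq, AlgEquiv.smul_def]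
    exact hloc
  -- the other hypotheses of the group lemma
  have h2 : Nat.card {c : ClassGroup (𝓞 K) // c ^ 2 = 1} = 2 := card_sq_eq_one_eq_two hK hl hq hlq hd
  have hcard : Nat.card (ClassGroup (𝓞 K)) = 2 * genusClassNumber K := card_classGroup_eq_two_mul_genusClassNumber hK hl hq hlq hd
  have heven : Even (genusClassNumber K) := even_genusClassNumber hRR hl hq hl4 hq4 hjac hKsq
  set wR := IntermediateField.inclusion (hilbertClassField_le_rayClassField (K := K) h𝔪) r with hwRdef
  have hkerS : ∀ π : rayClassField K 𝔪 ≃ₐ[K] rayClassField K 𝔪, res π = 1 → π • (s₀ * s₀) = s₀ * s₀ := by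
    intro π hπ; rw [← ha]; exact hker π hπ a
  have hkerw : ∀ π : rayClassField K 𝔪 ≃ₐ[K] rayClassField K 𝔪, res π = 1 → π • wR = wR := fun π hπ => hker π hπ r
  have hwsign : ∀ g' : rayClassField K 𝔪 ≃ₐ[K] rayClassField K 𝔪, g' • wR = wR ∨ g' • wR = -wR := by
    intro g'
    apply smul_eq_self_or_neg_of_smul_sq_eq
    rw [← pow_two, hr, AlgEquiv.smul_def, map_natCast]
  have hmove : ∃ g₀ : rayClassField K 𝔪 ≃ₐ[K] rayClassField K 𝔪, g₀ • wR ≠ wR := by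
    by_contra hall
    have hall' : ∀ g' : rayClassField K 𝔪 ≃ₐ[K] rayClassField K 𝔪, g' • wR = wR := fun g' => not_not.mp (not_exists.mp hall g')
    -- `wR` is fixed by all of `Gal(R/K)`, hence lies in `K`
    have hmem : wR ∈ IntermediateField.fixedField (⊤ : Subgroup (rayClassField K 𝔪 ≃ₐ[K] rayClassField K 𝔪)) := fun g' => hall' g'
    rw [← IntermediateField.fixingSubgroup_bot, IsGalois.fixedField_fixingSubgroup, IntermediateField.mem_bot] at hmem
    obtain ⟨k, hk⟩ := hmem
    apply not_isSquare_natCast_of_prime hK hl hl4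
    refine ⟨k, ?_⟩
    apply (algebraMap K (rayClassField K 𝔪)).injective
    rw [map_natCast, map_mul, hk, ← pow_two, hr]
  exact pow_smul_eq_self_of_smul_eq res hsurj s₀ wR hkerS hkerw hwsign hmove h2 p hp1 hp2 hps hcard heven g hg

end Summit.BirchSwinnertonDyer.PrintCf2.TheoremAOrderTwoGlobal

end
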